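import Literature.NumberTheory.CubicFields.PureCubicLexMinGamma
import Literature.NumberTheory.CubicFields.PureCubicLexMinScales
import Literature.NumberTheory.NumberFields.PureCubicDiscriminantBound
import HarnessLib

/-!
# The program `lexE`: the true scale lies in the scanned range

Topic `NumberTheory/CubicFields`, sub-namespace `PureCubicLexMin.Correctness`. Let
`c = (den, [h11, …, h33])` be a lattice code with positive diagonal whose member set is a fractional
ideal `I` of the pure cubic field `K = ℚ(θ)`, `θ³ = ab²` (`ab` squarefree, `ab ≠ 1`), and let `γ` be
least for the real conjugate `σ₁` in the open unit cylinder `{σ₁ > 0, ‖σ₂‖ < 1}` of `I`. PROVED here: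

* `diag_mul_mem` : `D (x + yθ + zθ₂) / den` is a member for every integer row, `D = h11 h22 h33`
  (`D ℤ³ ⊆ ℤ³ H`);
* `mem_of_mem_spanSingleton` : the principal fractional ideal `(3D/den) 𝓞_K` lies in `I` (Dedekind's
  `3 𝓞_K ⊆ ℤ⟨1, θ, θ₂⟩`, `PureCubic.three_mul_mem_order`);
* `sigma1_le_of_least` (**a priori upper bound**): `σ₁ γ ≤ 486 D³ ab`, from the cylinder minimum of
  `(3D/den) 𝓞_K` (`VoronoiReduction.exists_cylinder_min`: `σ₁ ≤ 3 N √|d_K|`, `N = (3D/den)³`,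
  `|d_K| ≤ 27 a²b²`);
* `natAbs_log_le` (**the scan range suffices**): `|⌊log₂ σ₁ γ⌋| ≤ 3L + 8`, `L` the length of the input
  code (`1/den³ < σ₁ γ`, `PureCubicLexMinGamma.inv_pow_lt_sigma1`, and the sizes `length_inE`,
  `length_rawE`).

## References

* J. Buchmann, H. C. Williams, *On the infrastructure of the principal ideal class of an algebraic
  number field of unit rank one*, Math. Comp. 50 (1988), §3. [folklore]
* H. Cohen, *A Course in Computational Algebraic Number Theory*, GTM 138 (1993), §6.5. [Cohen1993]
-/

noncomputable section

namespace Literature.NumberTheory.CubicFields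

namespace PureCubicLexMin

namespace Correctness

open Literature.Computability.Complexity Literature.Computability.Complexity.CodeFP
  Literature.Computability.QuantumComplexity Literature.NumberTheory.NumberFields PureCubicCodes
open scoped NumberField ComplexConjugate nonZeroDivisors

/-! ### A principal ideal inside the lattice -/

/-- **Multiples by the diagonal product are members**: for every integer row `(x, y, z)`,
`D (x + yθ + zθ₂) / den` is a member of the lattice code `(den, [h11, …, h33])`, `D = h11 h22 h33`
(`D e₁, D e₂, D e₃ ∈ ℤ³ H`). [folklore] -/
theorem diag_mul_mem {K : Type*} [Field K] [CharZero K] (θ : K) (b : ℕ) {den : ℕ} (hden : den ≠ 0)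
    (h11 h12 h13 h22 h23 h33 x y z : ℤ) :
    Mem θ b (den, [h11, h12, h13, h22, h23, h33])
      (((h11 * h22 * h33 : ℤ) : K) * (((x : ℤ) : K) + ((y : ℤ) : K) * θ + ((z : ℤ) : K) * (θ ^ 2 / (b : K))) /
        (den : K)) := by
  refine ⟨h11, h12, h13, h22, h23, h33, x * (h22 * h33), x * (-(h12 * h33)) + y * (h11 * h33),
    x * (h12 * h23 - h13 * h22) + y * (-(h11 * h23)) + z * (h11 * h22), rfl, ?_⟩
  show (den : K) * _ = _
  rw [mul_div_cancel₀ _ (Nat.cast_ne_zero.2 hden)]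
  push_cast
  ring

section Range

variable {K : Type*} [Field K] [NumberField K] {a b : ℕ} {θ : K} (σ₁ : K →+* ℝ) (σ₂ : K →+* ℂ)
  (hdeg : Module.finrank ℚ K = 3) (hab : Squarefree (a * b)) (hab1 : a * b ≠ 1)
  (hθ : θ ^ 3 = ((a * b ^ 2 : ℕ) : K)) (hσ₂ : ∃ z : K, conj (σ₂ z) ≠ σ₂ z)
  {den : ℕ} (hden : 1 ≤ den) {h11 h12 h13 h22 h23 h33 : ℤ} (p11 : 0 < h11) (p22 : 0 < h22) (p33 : 0 < h33)
  {I : FractionalIdeal (𝓞 K)⁰ K}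
  (hI : ∀ φ : K, Mem θ b (den, [h11, h12, h13, h22, h23, h33]) φ ↔ φ ∈ I)

include hdeg hab hab1 hθ hden hI in
/-- **The principal ideal `(3D/den) 𝓞_K` lies in `I`** (`D = h11 h22 h33`): `3 𝓞_K ⊆ ℤ⟨1, θ, θ₂⟩`
and `D ℤ⟨1, θ, θ₂⟩ / den ⊆ I`. [cite: Cohen1993, §6.5] -/
theorem mem_of_mem_spanSingleton {φ : K}
    (hφ : φ ∈ FractionalIdeal.spanSingleton (𝓞 K)⁰ (((3 * (h11 * h22 * h33) : ℤ) : K) / (den : K))) :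
    φ ∈ I := by
  rw [FractionalIdeal.mem_spanSingleton] at hφ
  obtain ⟨ξ, rfl⟩ := hφ
  obtain ⟨c₀, c₁, c₂, h3⟩ := PureCubic.three_mul_mem_order hdeg hab hab1 hθ ξ
  rw [← hI]
  have e : ξ • ((((3 * (h11 * h22 * h33) : ℤ)) : K) / (den : K)) =
      ((h11 * h22 * h33 : ℤ) : K) * (((c₀ : ℤ) : K) + ((c₁ : ℤ) : K) * θ + ((c₂ : ℤ) : K) * (θ ^ 2 / (b : K))) /
        (den : K) := by
    rw [Algebra.smul_def, ← NumberField.RingOfIntegers.coe_eq_algebraMap, ← h3]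
    push_cast
    ring
  rw [e]
  exact diag_mul_mem θ b (by omega) h11 h12 h13 h22 h23 h33 c₀ c₁ c₂

include hdeg hab hab1 hθ hσ₂ hden p11 p22 p33 hI in
/-- **A priori upper bound for the cylinder minimum**: if `γ` has `σ₁ γ ≤ σ₁ φ` for every `φ ∈ I`
in the open unit cylinder, then `σ₁ γ ≤ 486 · D³ · ab` (`D = h11 h22 h33`): the cylinder minimum of
the principal ideal `(3D/den) 𝓞_K ⊆ I` has real conjugate `≤ 3 (3D/den)³ √|d_K|` and
`|d_K| ≤ 27 a² b²`. [cite: Cohen1993, §6.5] -/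
theorem sigma1_le_of_least {γ : K} (hleast : ∀ φ : K, φ ∈ I → 0 < σ₁ φ → ‖σ₂ φ‖ < 1 → σ₁ γ ≤ σ₁ φ) :
    σ₁ γ ≤ 486 * ((h11 * h22 * h33 : ℤ) : ℝ) ^ 3 * ((a : ℝ) * b) := by
  obtain ⟨ha0, hb0⟩ := PureCubic.ne_zero_of_squarefree_mul hab
  set D : ℤ := h11 * h22 * h33 with hD
  have hD0 : 0 < D := by positivity
  set q : ℚ := ((3 * D : ℤ) : ℚ) / (den : ℚ) with hq
  have hq0 : 0 < q := by
    have : (0 : ℚ) < den := by exact_mod_cast hden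
    positivity
  have hqK : ((q : ℚ) : K) = ((3 * (h11 * h22 * h33) : ℤ) : K) / (den : K) := by
    rw [hq, Rat.cast_div, Rat.cast_intCast, Rat.cast_natCast]
  set J : FractionalIdeal (𝓞 K)⁰ K := FractionalIdeal.spanSingleton (𝓞 K)⁰ ((q : ℚ) : K) with hJ
  have hJ0 : J ≠ 0 := by
    rw [hJ, Ne, FractionalIdeal.spanSingleton_eq_zero_iff, Rat.cast_eq_zero]
    exact hq0.ne'
  obtain ⟨γ', hγ'J, hpos', h1', -, -, -, -, hup'⟩ := exists_cylinder_min (σ₁ := σ₁) hdeg hσ₂ hJ0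
  have hγ'I : γ' ∈ I := by
    refine mem_of_mem_spanSingleton hdeg hab hab1 hθ hden hI ?_
    rw [← hqK]; exact hγ'J
  have hle := hleast γ' hγ'I hpos' h1'
  -- `N(J) = q³`
  have hnq : Algebra.norm ℚ ((q : ℚ) : K) = q ^ 3 := by
    rw [← hdeg, ← Algebra.norm_algebraMap (S := K) q, eq_ratCast]
  have hNJ : ((FractionalIdeal.absNorm J : ℚ) : ℝ) = (q : ℝ) ^ 3 := by
    rw [hJ, FractionalIdeal.absNorm_span_singleton (𝓞 K), hnq, abs_of_pos (pow_pos hq0 3)]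
    push_cast
    rfl
  have hq3 : (q : ℝ) ≤ 3 * (D : ℝ) := by
    have hd1 : (1 : ℝ) ≤ den := by exact_mod_cast hden
    have hD0' : (0 : ℝ) ≤ 3 * (D : ℝ) := by positivity
    rw [hq]
    push_cast
    exact div_le_self hD0' hd1
  have hq0' : (0 : ℝ) ≤ (q : ℝ) := by exact_mod_cast hq0.le
  -- `√|d_K| ≤ 6ab`
  have hdisc : Real.sqrt |(NumberField.discr K : ℝ)| ≤ 6 * ((a : ℝ) * b) := by
    have h27 := PureCubic.abs_discr_le hdeg hab hab1 hθ
    have h27' : |(NumberField.discr K : ℝ)| ≤ 27 * (a : ℝ) ^ 2 * (b : ℝ) ^ 2 := by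
      rw [← Int.cast_abs]; exact_mod_cast h27
    calc Real.sqrt |(NumberField.discr K : ℝ)| ≤ Real.sqrt ((6 * ((a : ℝ) * b)) ^ 2) :=
          Real.sqrt_le_sqrt (by nlinarith [sq_nonneg ((a : ℝ) * b)])
      _ = 6 * ((a : ℝ) * b) := Real.sqrt_sq (by positivity)
  have hsq0 : 0 ≤ Real.sqrt |(NumberField.discr K : ℝ)| := Real.sqrt_nonneg _
  calc σ₁ γ ≤ σ₁ γ' := hle
    _ ≤ 3 * ((FractionalIdeal.absNorm J : ℚ) : ℝ) * Real.sqrt |(NumberField.discr K : ℝ)| := hup'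
    _ = 3 * (q : ℝ) ^ 3 * Real.sqrt |(NumberField.discr K : ℝ)| := by rw [hNJ]
    _ ≤ 3 * (3 * (D : ℝ)) ^ 3 * (6 * ((a : ℝ) * b)) := by
        gcongr
    _ = 486 * (D : ℝ) ^ 3 * ((a : ℝ) * b) := by ring

/-- The arithmetic of the scan range: `−3L ≤ s < 9 + 3(ℓ11 + ℓ22 + ℓ33) + ℓa + ℓb` and the length
identity `L = 4ℓa + 2ℓb + 2ℓ_den + 2 Σ ℓᵢⱼ + 20` give `|s| ≤ 3L + 8`. [folklore] -/
theorem natAbs_le_of_range {L R la lb ld l11 l12 l13 l22 l23 l33 M : ℕ} {s : ℤ}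
    (hL : L = 2 * (2 * la + 2 + lb) + 2 + (2 * ld + 2 + R))
    (hR : R = 2 * l11 + 2 + (2 * l12 + 2 + (2 * l13 + 2 + (2 * l22 + 2 + (2 * l23 + 2 + (2 * l33 + 2))))))
    (hM : M = 9 + 3 * (l11 + l22 + l33) + la + lb)
    (hlo : -((3 * L : ℕ) : ℤ) ≤ s) (hhi : s < (M : ℤ)) : s.natAbs ≤ 3 * L + 8 := by
  omega

include hdeg hab hab1 hθ hσ₂ hden p11 p22 p33 hI in
/-- **The true scale lies in the scanned range**: `|⌊log₂ σ₁ γ⌋| ≤ 3L + 8` for the length `L` of the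
input code, when `γ` is least in the unit cylinder of `I`, lies in it, and `den γ = cγ H (1, θ, θ₂)`
(`2^{-3L} < 1/den³ < σ₁ γ ≤ 486 D³ ab < 2^{3L+9}`). [cite: Cohen1993, §6.5] -/
theorem natAbs_log_le {γ : K} (hleast : ∀ φ : K, φ ∈ I → 0 < σ₁ φ → ‖σ₂ φ‖ < 1 → σ₁ γ ≤ σ₁ φ)
    (hpos : 0 < σ₁ γ) (h1 : ‖σ₂ γ‖ < 1) {cγ : Fin 3 → ℤ}
    (hcγ : (den : K) * γ = lin θ b (cγ 0 * h11, cγ 0 * h12 + cγ 1 * h22, cγ 0 * h13 + cγ 1 * h23 + cγ 2 * h33)) :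
    (Int.log 2 (σ₁ γ)).natAbs ≤ 3 * (inE ((a, b), (den, [h11, h12, h13, h22, h23, h33]))).length + 8 := by
  have hden0 : den ≠ 0 := by omega
  -- the sizes read off the code
  obtain ⟨-, -, hdL, -, -, -⟩ := bounds_of_input a b den [h11, h12, h13, h22, h23, h33]
  have hL := length_inE a b den [h11, h12, h13, h22, h23, h33]
  have hR : (rawE intE [h11, h12, h13, h22, h23, h33]).length = 2 * (intE h11).length + 2 +
      (2 * (intE h12).length + 2 + (2 * (intE h13).length + 2 + (2 * (intE h22).length + 2 +
        (2 * (intE h23).length + 2 + (2 * (intE h33).length + 2))))) := by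
    rw [length_rawE]
    simp [List.sum_cons]
  have e11 : h11.natAbs < 2 ^ (intE h11).length := natAbs_lt_two_pow_length_intE h11
  have e22 : h22.natAbs < 2 ^ (intE h22).length := natAbs_lt_two_pow_length_intE h22
  have e33 : h33.natAbs < 2 ^ (intE h33).length := natAbs_lt_two_pow_length_intE h33
  have ea : a < 2 ^ (natE a).length := lt_two_pow_length_natE a
  have eb : b < 2 ^ (natE b).length := lt_two_pow_length_natE b
  set L := (inE ((a, b), (den, [h11, h12, h13, h22, h23, h33]))).length with hLdef
  set R := (rawE intE [h11, h12, h13, h22, h23, h33]).length with hRdef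
  set la := (natE a).length with hla
  set lb := (natE b).length with hlb
  set ld := (natE den).length with hld
  set l11 := (intE h11).length with hl11
  set l12 := (intE h12).length with hl12
  set l13 := (intE h13).length with hl13
  set l22 := (intE h22).length with hl22
  set l23 := (intE h23).length with hl23
  set l33 := (intE h33).length with hl33
  clear_value L R la lb ld l11 l12 l13 l22 l23 l33
  -- lower bound: `2^{-3L} < σ₁ γ`
  have hlow : ((2 : ℝ) ^ (3 * L))⁻¹ < σ₁ γ := by
    have h := inv_pow_lt_sigma1 σ₁ σ₂ hdeg hab hab1 hθ hσ₂ hden0 hcγ hpos h1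
    refine lt_of_le_of_lt ?_ h
    rw [one_div]
    have hd0 : (0 : ℝ) < (den : ℝ) ^ 3 := by positivity
    refine (inv_le_inv₀ (by positivity) hd0).2 ?_
    have hdL' : (den : ℝ) ≤ 2 ^ L := by exact_mod_cast hdL.le
    calc (den : ℝ) ^ 3 ≤ (2 ^ L) ^ 3 := pow_le_pow_left₀ (by positivity) hdL' 3
      _ = 2 ^ (3 * L) := by rw [← pow_mul, mul_comm]
  have hlo := int_log_lower hlow
  -- upper bound: `σ₁ γ < 2^{9 + 3(ℓ11 + ℓ22 + ℓ33) + ℓa + ℓb}`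
  set M := 9 + 3 * (l11 + l22 + l33) + la + lb with hM
  have hup : σ₁ γ < (2 : ℝ) ^ M := by
    have hle := sigma1_le_of_least σ₁ σ₂ hdeg hab hab1 hθ hσ₂ hden p11 p22 p33 hI hleast
    -- the natural number `D³ ab` against the lengths
    have hDn : h11.natAbs * h22.natAbs * h33.natAbs < 2 ^ l11 * 2 ^ l22 * 2 ^ l33 :=
      Nat.mul_lt_mul'' (Nat.mul_lt_mul'' e11 e22) e33
    have hprod : (h11.natAbs * h22.natAbs * h33.natAbs) ^ 3 * (a * b) <
        (2 ^ l11 * 2 ^ l22 * 2 ^ l33) ^ 3 * (2 ^ la * 2 ^ lb) :=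
      Nat.mul_lt_mul'' (Nat.pow_lt_pow_left hDn (by norm_num)) (Nat.mul_lt_mul'' ea eb)
    have hpow : (2 ^ l11 * 2 ^ l22 * 2 ^ l33) ^ 3 * (2 ^ la * 2 ^ lb) = 2 ^ (3 * (l11 + l22 + l33) + la + lb) := by
      rw [pow_add, pow_add, pow_mul', pow_add, pow_add]; ring
    rw [hpow] at hprod
    have c11 : ((h11.natAbs : ℕ) : ℝ) = (h11 : ℝ) := by
      rw [← Int.cast_natCast (R := ℝ) h11.natAbs, Int.natAbs_of_nonneg p11.le]
    have c22 : ((h22.natAbs : ℕ) : ℝ) = (h22 : ℝ) := by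
      rw [← Int.cast_natCast (R := ℝ) h22.natAbs, Int.natAbs_of_nonneg p22.le]
    have c33 : ((h33.natAbs : ℕ) : ℝ) = (h33 : ℝ) := by
      rw [← Int.cast_natCast (R := ℝ) h33.natAbs, Int.natAbs_of_nonneg p33.le]
    have hcast : ((h11 * h22 * h33 : ℤ) : ℝ) ^ 3 * ((a : ℝ) * b) =
        (((h11.natAbs * h22.natAbs * h33.natAbs) ^ 3 * (a * b) : ℕ) : ℝ) := by
      rw [Nat.cast_mul, Nat.cast_pow, Nat.cast_mul, Nat.cast_mul, Nat.cast_mul, c11, c22, c33]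
      push_cast
      ring
    have hprod' : ((h11 * h22 * h33 : ℤ) : ℝ) ^ 3 * ((a : ℝ) * b) < (2 : ℝ) ^ (3 * (l11 + l22 + l33) + la + lb) := by
      rw [hcast]; exact_mod_cast hprod
    have h0 : (0 : ℝ) ≤ ((h11 * h22 * h33 : ℤ) : ℝ) ^ 3 * ((a : ℝ) * b) := by rw [hcast]; positivity
    have h486 := mul_lt_mul_of_pos_left hprod' (by norm_num : (0 : ℝ) < 486)
    have h2M : (2 : ℝ) ^ M = 512 * (2 : ℝ) ^ (3 * (l11 + l22 + l33) + la + lb) := by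
      rw [hM, show 9 + 3 * (l11 + l22 + l33) + la + lb = 9 + (3 * (l11 + l22 + l33) + la + lb) by ring, pow_add]
      norm_num
    rw [h2M]
    calc σ₁ γ ≤ 486 * ((h11 * h22 * h33 : ℤ) : ℝ) ^ 3 * ((a : ℝ) * b) := hle
      _ = 486 * (((h11 * h22 * h33 : ℤ) : ℝ) ^ 3 * ((a : ℝ) * b)) := by ring
      _ < 512 * (2 : ℝ) ^ (3 * (l11 + l22 + l33) + la + lb) := by linarith only [h486, h0, hprod']
  have hhi := int_log_upper hpos hup
  set s := Int.log 2 (σ₁ γ) with hsdef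
  clear_value s
  exact natAbs_le_of_range hL hR hM hlo hhi

end Range

end Correctness

end PureCubicLexMin

end Literature.NumberTheory.CubicFields

end
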